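import Literature.MathematicalPhysics.QuantumFieldTheory.Balaban1983to89.B9RWSums346MixedFactorAtRecord
import Literature.MathematicalPhysics.QuantumFieldTheory.Balaban1983to89.B9RWSumsDefinitePinsPairM

/-!
# `Balaban1983to89.B9RWSums346MixedFactorOfLegsY` — T. Bałaban, *Propagators for lattice gauge theories in a background field*, Commun. Math. Phys. **99** (1985) 389–434
# [Balaban1985BackgroundPropagators], (3.88)–(3.89) p. 409 with Thm 3.1 (3.46) p. 398 and *Propagators … II*, CMP **96** (1984) [Balaban1984PropagatorsII], Lemma 2.1
# (2.59)–(2.61) pp. 233–234: ROWS 18's THIRD-ORDER MIXED FACTOR `FactorsL2Mixed37Dir` AT A GENERIC CUBE LETTER, FROM THE TWO PER-CUBE (3.46) LEGS DISPLAYED — the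
# letter-generic twin of dag-n06-w7's record theorem `factorsL2Mixed37Dir_memberY_record(_at)` and of the certificate reader `factorsL2Mixed37Dir_of_pinsR`
# (pub-ymgap N06 [B9]; dag-n06-d g24 «WANT (b)», I.18886)

statement-level skeleton of published theorems with citation tags; proofs where landed; nothing here is a claim about the Yang–Mills mass gap

THE PRINT.  (3.88)–(3.89) p. 409: the random-walk expansion of `G(U)` over the cubes `□` with the letters `P_□∇_U + C_□` acting on `G′_□(U)h_□`; (3.46) p. 398 (Thm 3.1):
`|(∇^{η}_U)^α G′(Ω′_j; x, y)(∇^{η}_U)^β| ≦ O(1)(L^jη)^{−2+…} e^{−δ₀ d_j(x,y)}` — the mixed second derivative of the cube propagator decays; Cor 3.6 p. 408 puts the cube letters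
`G′_□(U)` in this class; [4] Lemma 2.1 (2.59)–(2.61): sums of block-decaying kernels over the multi-level geometry.

WHY THIS FILE (pub-ymgap node N06 [B9], rows 18 of the stage-11 certificate at the GENERIC cube letter `O` — dag-n06-d's editions «VY» ✓p774668 ∕ «VZ» ✓p775276 display
`hfacO : … Reg335 c α₀ U → FactorsL2Mixed37Dir (opsWalkYO … (O x)) (dirOpsWalkYO …) (dirLettersWalkYO …) 1 (H x) pM.θM p.δ₀ U`).  At the RECORD letter (`𝔬.Gsq = gsqcoS`, the
`G′_□²` sandwich at `GpPhysY`) dag-n06-w7's chain derives this composite from the member's class (3.35): the ONLY letter-specific inputs are dag-n06-w1's per-cube (3.46) torus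
bounds (`blockBd_mixedLegR_memberY`, `blockBd_oneLeg_memberY` — the uncut mixed leg `∇_νG′_□²M_{h_□}∇*_μ` and the first-order leg `G′_□²M_{h_□}∇*_μ`); everything after them
(`factorsL2Mixed37Dir_of_identities₂_legs`, Lemma 2.1's inputs at the record geometry `lemma21_geo9Y_record`, the member-uniform constant `factorsL2Mixed37Dir_uniform_of_bounded`,
monotonicity) is LETTER-GENERIC.  For a generic cube letter no (3.46) theorem exists in the tree, so THIS FILE displays the two legs and runs the generic tail:
* §1 ★★ `factorsL2Mixed37Dir_memberY_of_legs` — `∃ M_th B_K > 0` (functions of `d ℓ b₀ b₁ M⋆` and the legs' rate `δ_M`): for every member above `M_th`, every `H₀`, ANY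
  backgrounds `B`, carriers `X Y ι` and walk-letter records `𝔬 𝔡 𝔩` over `geo9Y x`, every configuration `U`, the displayed `StaticOK`, `Sizes.Bounded K_c θ₀ C_ℓ M_x`
  (`θ₀ ≥ 0`, `C_ℓ ≥ 1`), `Identities₂ 𝔬 𝔡 𝔩 1 H₀ U`, the two letter transposes, and the two LEGS at `(B_M, δ_M)` for all cubes and directions ⟹
  `FactorsL2Mixed37Dir 𝔬 𝔡 𝔩 1 H₀ (θ₀·e^{(3∕4+ρ′)ρ}·(B_K·B_M)) ρ′ U` for `0 ≤ ρ′ ≤ δ_M∕2` — NO regime hypothesis (the class enters only through the displayed legs);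
* §2 the constants NAMED (`MLeg`, `BLeg` by `Classical.choose`, signs `MLeg_pos`, `BLeg_pos`) and the theorem restated at them (★★ `factorsL2Mixed37Dir_memberY_of_legs_at`)
  — dag-n06-w7's «supplier `∃`-constants that meet displayed numerics must be NAMED»;
* §3 ★★★ `factorsL2Mixed37Dir_of_legs` — THE CERTIFICATE-SHAPED READER (twin of `factorsL2Mixed37Dir_of_pinsR`): member family of records `𝔬 x : Ops (geo9Y x) (B x) (X x)
  (Y x) (ι x)`, regime prefix `p.M₁ ≤ M_x → α₀ > 0 → c·M_x·α₀ ≤ p.a₁ → (B x).Reg335 c α₀ U →` carried verbatim, displayed `hIds hPt hCt` and the legs `hMix hOne` in that prefix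
  at `(pM.BM, δ_M)`, numerics `MLeg ≤ p.M₁`, `p.δ₀ ≤ δ_M∕2`, `p.θ₀·e^{(3∕4+p.δ₀)p.ρ}·BLeg·pM.BM ≤ pM.θM` ⟹ `FactorsL2Mixed37Dir (𝔬 x) (𝔡 x) (𝔩 x) 1 (H x) pM.θM p.δ₀ U` — at
  `𝔬 x := opsWalkYO x (trBasis N) (bg9YR …) id (parSymY x.toKIdx) (bI x) (O x)` this is dag-n06-d's `hfacO` DERIVED from `hMixO + hOneO`.
NOTE ON `hmixO`.  The certificate's other O-binder `hmixO : … → L2MixedLegs37 (𝔬 x) (𝔡 x) 1 (H x) (SblkY x (bI x)) pM.BM p.δ₀ U` IS ALREADY a per-cube (3.46) leg (the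
two-sided `∇_ν M_h G′_□² M_h ∇*_μ` with the support indicator, `B9RWSums346MixedPair.L2MixedLegs37.lm`) — its generic-O «twin» is the identity; nothing to derive.

HONEST SCOPE ∕ NOT CLAIMED.  Composition of LANDED letter-generic theorems by name (dag-n06-w7 `factorsL2Mixed37Dir_of_identities₂_legs`, `lemma21_geo9Y_record`,
`factorsL2Mixed37Dir_uniform_of_bounded`, `factorsL2Mixed37Dir_mono`); the two (3.46) legs, `Identities₂`, the transposes, `StaticOK`, `Sizes.Bounded` are HYPOTHESES; no
estimate of [B9] is proved here; the per-cube (3.43)–(3.47) entries for a generic cube letter remain ABSENT from the tree (census I.18198); count-neutral; rows 18 ∕ N06 NOT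
discharged; nothing continuum ∕ OS ∕ mass gap ∕ Clay.  NEW file (definition lane: 2 `def` by `Classical.choose`); no `sorry`, no `axiom`, no `instance`, no `notation`.  Cell
`pub-ymgap` (D-0062), seat `pub-ymgap-dag-n06-c` (gen 23), 2026-08-30; `--supports stmt-QuantumFields-27364`.  Net new unproved facts: 0.

RELATED IN THE TREE, NOT DUPLICATED (searched 2026-08-30: `rg` for the basename and the decl names over `lean/Literature` + `lean/Summits` — 0 hits): dag-n06-w7
`B9RWSums346MixedFactorAtPins(Closed)` ∕ `…AtRecord(Closed)` (the RECORD-letter chain, legs derived from (3.35); USED for the generic tail), `B9RWSums346LetterL2FromMajorants`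
(`factorsL2Mixed37Dir_of_identities₂_legs`, USED), dag-n06-d `Summits/…/BalabanUVNodesN06MixedFactorAtPinsPhysR` (`factorsL2Mixed37Dir_of_pinsR`, the record reader this
twins), this seat's `B9Local342AtOpsWalkYO` (the (α) face: (3.42) for the O-walk record from block data — a different row).
-/

noncomputable section

namespace Literature.MathematicalPhysics.QuantumFieldTheory.Balaban1983to89.B9RWSums346MixedFactorOfLegsY

open Literature.MathematicalPhysics.QuantumFieldTheory.Balaban1983to89
open Literature.MathematicalPhysics.QuantumFieldTheory.Balaban1983to89.B6RandomWalk (Ineq261 c1_nonneg)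
open Literature.MathematicalPhysics.QuantumFieldTheory.Balaban1983to89.B9Thm34Ext (toB6)
open Literature.MathematicalPhysics.QuantumFieldTheory.Balaban1983to89.B9PinMembersKLevelV1 (MemberY geo9Y)
open Literature.MathematicalPhysics.QuantumFieldTheory.Balaban1983to89.B9Thm37Sum (mulOp)
open Literature.MathematicalPhysics.QuantumFieldTheory.Balaban1983to89.B9Thm37Glue (IsTransposePair)
open Literature.MathematicalPhysics.QuantumFieldTheory.Balaban1983to89.B9Thm37Whole (Ops StaticOK Sizes)
open Literature.MathematicalPhysics.QuantumFieldTheory.Balaban1983to89.B9Thm37WholeDir (DirLetters37 Identities₂)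
open Literature.MathematicalPhysics.QuantumFieldTheory.Balaban1983to89.B9Thm37KLetterDir (FactorsL2Mixed37Dir)
open Literature.MathematicalPhysics.QuantumFieldTheory.Balaban1983to89.B9RWSums346SecondDiffGp (DirOps37)
open Literature.MathematicalPhysics.QuantumFieldTheory.Balaban1983to89.B9RWSums343to347Whole (Facts347)
open Literature.MathematicalPhysics.QuantumFieldTheory.Balaban1983to89.B9SectDL2Decay (BlockBd)
open Literature.MathematicalPhysics.QuantumFieldTheory.Balaban1983to89.B9RWSums346LetterL2FromMajorants (factorsL2Mixed37Dir_of_identities₂_legs)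
open Literature.MathematicalPhysics.QuantumFieldTheory.Balaban1983to89.B9RWSums346MixedFactorAtPins (factorsL2Mixed37Dir_mono factorsL2Mixed37Dir_uniform_of_bounded)
open Literature.MathematicalPhysics.QuantumFieldTheory.Balaban1983to89.B9RWSums346MixedFactorAtRecord (lemma21_geo9Y_record)
open Literature.MathematicalPhysics.QuantumFieldTheory.Balaban1983to89.B9RWSumsDefinitePins (PinPrims)
open Literature.MathematicalPhysics.QuantumFieldTheory.Balaban1983to89.B9RWSumsDefinitePinsPairM (MixedPrims)
open scoped Matrix Matrix.Norms.L2Operator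

section StageY

variable (d ℓ : ℕ) (hd : 1 ≤ d + 1) (hL : Odd (ℓ + 1) ∧ 1 < ℓ + 1) (b₀ b₁ : ℝ) (Mstar : ℕ)
variable [∀ x : MemberY d ℓ hd hL b₀ b₁ Mstar, Fintype (geo9Y x).Site]

/-! ## §1 The schema from the two displayed legs, letter-generic, constant member-uniform -/

/-- ★★ **ROWS 18's `FactorsL2Mixed37Dir` FROM THE TWO PER-CUBE (3.46) LEGS, AT ANY CUBE LETTER**: for a legs' rate `δ_M > 0` there are `M_th, B_K > 0` such that for every
member `x` with `M_th ≤ M_x`, every `H₀`, any backgrounds `B`, carriers `X Y ι` and records `𝔬 : Ops (geo9Y x) B X Y ι`, `𝔡`, `𝔩`, every `U : B.Cfg`, the displayed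
`StaticOK 𝔬 ρ Nn N′ C_ℓ κ`, `κ.Bounded K_c θ₀ C_ℓ M_x` (`0 ≤ θ₀`, `1 ≤ C_ℓ`), `Identities₂ 𝔬 𝔡 𝔩 1 H₀ U`, the transposes `Pᵗ_{□,ν} = (P_{□,ν})ᵗ`, `Cᵗ_□ = (C_□)ᵗ`, and the two
LEGS — the uncut mixed leg `∇_ν 𝔬.Gsq_□ M_{h_□} ∇*_μ` with block bound `B_M·e^{−δ_M d}` and the first-order leg `𝔬.Gsq_□ M_{h_□} ∇*_μ` with `B_M·len·e^{−δ_M d}` (`B_M ≥ 0`) —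
every `0 ≤ ρ′ ≤ δ_M∕2` gives `FactorsL2Mixed37Dir 𝔬 𝔡 𝔩 1 H₀ (θ₀·e^{(3∕4+ρ′)ρ}·(B_K·B_M)) ρ′ U`.  No regime hypothesis: the class (3.35) enters only through the legs.
[cite: Balaban1985BackgroundPropagators, (3.88)–(3.89) p.409, Thm 3.1 (3.46) p.398, Cor 3.6 p.408; Balaban1984PropagatorsII, (2.39)–(2.44) pp.229–230, (2.52)–(2.55) p.232, Lemma 2.1 (2.59)–(2.61) pp.233–234] -/
theorem factorsL2Mixed37Dir_memberY_of_legs {δM : ℝ} (hδM : 0 < δM) :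
    ∃ Mth BK : ℝ, 0 < Mth ∧ 0 < BK ∧
      ∀ (x : MemberY d ℓ hd hL b₀ b₁ Mstar), Mth ≤ (geo9Y x).M → ∀ (H₀ : Prop) [DecidableEq (geo9Y x).Site]
        {B : B9.Backgrounds} {X Y ι : Type} [Fintype X] [Fintype Y] [Fintype ι]
        (𝔬 : Ops (geo9Y x) B X Y ι) (𝔡 : DirOps37 𝔬 (Fin (d + 1))) (𝔩 : DirLetters37 𝔬 (Fin (d + 1))) (U : B.Cfg)
        {ρ Nn N' Cℓ Kc θ₀ : ℝ} {κ : Sizes} (_ : StaticOK 𝔬 ρ Nn N' Cℓ κ) (_ : κ.Bounded Kc θ₀ Cℓ (geo9Y x).M) (_ : 0 ≤ θ₀) (_ : 1 ≤ Cℓ)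
        (_ : Identities₂ 𝔬 𝔡 𝔩 1 H₀ U)
        (_ : ∀ c ν, IsTransposePair (𝔩.Pt U c ν) (𝔩.P U c ν)) (_ : ∀ c, IsTransposePair (𝔬.Ct U c) (𝔬.Cop U c))
        {BM : ℝ} (_ : 0 ≤ BM)
        (_ : ∀ (c : ι) (ν μ : Fin (d + 1)), BlockBd (g := toB6 (geo9Y x) 1 H₀) 𝔬.blk 𝔬.blk (𝔡.Dd U ν ∘ₗ ((𝔬.Gsq U c * mulOp (𝔬.h c)) ∘ₗ 𝔡.Dsd U μ))
          (fun (y y' : (geo9Y x).Site) => BM * Real.exp (-(δM * (geo9Y x).dist y y'))))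
        (_ : ∀ (c : ι) (μ : Fin (d + 1)), BlockBd (g := toB6 (geo9Y x) 1 H₀) 𝔬.blk 𝔬.blk ((𝔬.Gsq U c * mulOp (𝔬.h c)) ∘ₗ 𝔡.Dsd U μ)
          (fun (y y' : (geo9Y x).Site) => BM * (geo9Y x).len y ^ (1 : ℝ) * Real.exp (-(δM * (geo9Y x).dist y y'))))
        {ρ' : ℝ} (_ : 0 ≤ ρ') (_ : ρ' ≤ δM / 2),
        FactorsL2Mixed37Dir 𝔬 𝔡 𝔩 1 H₀ (θ₀ * Real.exp ((3 / 4 + ρ') * ρ) * (BK * BM)) ρ' U := by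
  obtain ⟨Mth, d₁, dF, hth⟩ := lemma21_geo9Y_record d ℓ hd hL b₀ b₁ Mstar hδM
  -- the member-uniform factor `B_K := max 1 (c₁(d₁, δ_M, ½) · ((d+1)·√(L₀^{|1|}) + √(L₀^{|2|})·L₀))`, `L₀ = ℓ + 1`
  refine ⟨max Mth 1,
    max 1 (B6.c1 d₁ δM (1 / 2) *
      (((Fintype.card (Fin (d + 1)) : ℝ)) * Real.sqrt (((ℓ + 1 : ℕ) : ℝ) ^ |(1 : ℝ)|) + Real.sqrt (((ℓ + 1 : ℕ) : ℝ) ^ |(2 : ℝ)|) * ((ℓ + 1 : ℕ) : ℝ))),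
    lt_max_of_lt_right one_pos, lt_max_of_lt_left one_pos, ?_⟩
  intro x hM H₀ _ B X Y ι _ _ _ 𝔬 𝔡 𝔩 U ρ Nn N' Cℓ Kc θ₀ κ hs hκB hθ₀ hCℓ hi hPt hCt BM hBM hMix hOne ρ' hρ'0 hρ'
  have hMth : Mth ≤ (geo9Y x).M := (le_max_left _ _).trans hM
  have h1M : 1 ≤ (geo9Y x).M := (le_max_right _ _).trans hM
  obtain ⟨h261, hF⟩ := hth H₀ x hMth
  have hαδ : (0 : ℝ) ≤ 1 / 2 * 1 := by norm_num
  have hrate : ρ' ≤ (1 - 1 / 2) * δM := by linarith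
  -- the letter-generic reader at the record's Lemma-2.1 facts (`αδ = ½`, `α₁ = ½`), transposes re-ordered
  have key := factorsL2Mixed37Dir_of_identities₂_legs 𝔬 𝔡 𝔩 1 H₀ dF d₁ 1 (1 / 2) (((ℓ + 1 : ℕ) : ℝ)) δM (1 / 2) ρ Nn N' Cℓ ρ' BM BM κ U
    hBM hBM hρ'0 hrate hαδ hs hκB.nonneg h261 hF hi (fun c ν => (hPt c ν).symm) (fun c => (hCt c).symm) hMix hOne
  -- the letter sizes leave the constant (`κ.Bounded`, `M_x ≥ 1`, `C_ℓ ≥ 1`)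
  have hL₀ : (0 : ℝ) ≤ ((ℓ + 1 : ℕ) : ℝ) := Nat.cast_nonneg _
  have key2 := factorsL2Mixed37Dir_uniform_of_bounded 𝔬 𝔡 𝔩 U hκB h1M hCℓ hθ₀ (Nat.cast_nonneg _) hL₀ (Real.exp_nonneg _) hBM
    (c1_nonneg d₁ δM (1 / 2)) hs.dnn hs.lenpos key
  have he : Real.exp ((1 / 2 * 1 / 2 + (1 / 2 * 1 + ρ')) * ρ) = Real.exp ((3 / 4 + ρ') * ρ) := by
    congr 1; ring
  rw [he] at key2
  refine factorsL2Mixed37Dir_mono 𝔬 𝔡 𝔩 U ?_ ?_ le_rfl hs.dnn hs.lenpos key2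
  · have hc := c1_nonneg d₁ δM (1 / 2)
    positivity
  · set e := Real.exp ((3 / 4 + ρ') * ρ) with he_def
    have he0 : 0 ≤ e := Real.exp_nonneg _
    have hid : ((Fintype.card (Fin (d + 1)) : ℝ) * ((θ₀ * Real.sqrt (((ℓ + 1 : ℕ) : ℝ) ^ |(1 : ℝ)|) * e) * BM) +
        (θ₀ * Real.sqrt (((ℓ + 1 : ℕ) : ℝ) ^ |(2 : ℝ)|) * e) * (BM * ((ℓ + 1 : ℕ) : ℝ))) * B6.c1 d₁ δM (1 / 2) =
        θ₀ * e * ((B6.c1 d₁ δM (1 / 2) *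
          (((Fintype.card (Fin (d + 1)) : ℝ)) * Real.sqrt (((ℓ + 1 : ℕ) : ℝ) ^ |(1 : ℝ)|) + Real.sqrt (((ℓ + 1 : ℕ) : ℝ) ^ |(2 : ℝ)|) * ((ℓ + 1 : ℕ) : ℝ))) * BM) := by
      ring
    rw [hid]
    exact mul_le_mul_of_nonneg_left (mul_le_mul_of_nonneg_right (le_max_right _ _) hBM) (mul_nonneg hθ₀ he0)

/-! ## §2 The constants named, the theorem restated at them -/

/-- the member threshold `M_th(δ_M)` of §1, named. [cite: Balaban1984PropagatorsII, Lemma 2.1 (2.61) p.234, bookkeeping] -/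
def MLeg {δM : ℝ} (hδM : 0 < δM) : ℝ := (factorsL2Mixed37Dir_memberY_of_legs d ℓ hd hL b₀ b₁ Mstar hδM).choose

/-- the member-uniform factor `B_K(δ_M)` of §1, named. [cite: Balaban1985BackgroundPropagators, (3.89) p.409, bookkeeping] -/
def BLeg {δM : ℝ} (hδM : 0 < δM) : ℝ := (factorsL2Mixed37Dir_memberY_of_legs d ℓ hd hL b₀ b₁ Mstar hδM).choose_spec.choose

/-- `0 < MLeg`. [cite: Balaban1984PropagatorsII, Lemma 2.1 p.234, bookkeeping] -/
theorem MLeg_pos {δM : ℝ} (hδM : 0 < δM) : 0 < MLeg d ℓ hd hL b₀ b₁ Mstar hδM :=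
  (factorsL2Mixed37Dir_memberY_of_legs d ℓ hd hL b₀ b₁ Mstar hδM).choose_spec.choose_spec.1

/-- `0 < BLeg`. [cite: Balaban1985BackgroundPropagators, (3.89) p.409, bookkeeping] -/
theorem BLeg_pos {δM : ℝ} (hδM : 0 < δM) : 0 < BLeg d ℓ hd hL b₀ b₁ Mstar hδM :=
  (factorsL2Mixed37Dir_memberY_of_legs d ℓ hd hL b₀ b₁ Mstar hδM).choose_spec.choose_spec.2.1

/-- ★★ **§1 AT THE NAMED CONSTANTS** `MLeg`, `BLeg`. [cite: Balaban1985BackgroundPropagators, (3.88)–(3.89) p.409, Thm 3.1 (3.46) p.398; Balaban1984PropagatorsII, Lemma 2.1 (2.59)–(2.61) pp.233–234] -/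
theorem factorsL2Mixed37Dir_memberY_of_legs_at {δM : ℝ} (hδM : 0 < δM)
    (x : MemberY d ℓ hd hL b₀ b₁ Mstar) (hM : MLeg d ℓ hd hL b₀ b₁ Mstar hδM ≤ (geo9Y x).M) (H₀ : Prop) [DecidableEq (geo9Y x).Site]
    {B : B9.Backgrounds} {X Y ι : Type} [Fintype X] [Fintype Y] [Fintype ι]
    (𝔬 : Ops (geo9Y x) B X Y ι) (𝔡 : DirOps37 𝔬 (Fin (d + 1))) (𝔩 : DirLetters37 𝔬 (Fin (d + 1))) (U : B.Cfg)
    {ρ Nn N' Cℓ Kc θ₀ : ℝ} {κ : Sizes} (hs : StaticOK 𝔬 ρ Nn N' Cℓ κ) (hκ : κ.Bounded Kc θ₀ Cℓ (geo9Y x).M) (hθ₀ : 0 ≤ θ₀) (hCℓ : 1 ≤ Cℓ)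
    (hi : Identities₂ 𝔬 𝔡 𝔩 1 H₀ U)
    (hPt : ∀ c ν, IsTransposePair (𝔩.Pt U c ν) (𝔩.P U c ν)) (hCt : ∀ c, IsTransposePair (𝔬.Ct U c) (𝔬.Cop U c))
    {BM : ℝ} (hBM : 0 ≤ BM)
    (hMix : ∀ (c : ι) (ν μ : Fin (d + 1)), BlockBd (g := toB6 (geo9Y x) 1 H₀) 𝔬.blk 𝔬.blk (𝔡.Dd U ν ∘ₗ ((𝔬.Gsq U c * mulOp (𝔬.h c)) ∘ₗ 𝔡.Dsd U μ))
      (fun (y y' : (geo9Y x).Site) => BM * Real.exp (-(δM * (geo9Y x).dist y y'))))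
    (hOne : ∀ (c : ι) (μ : Fin (d + 1)), BlockBd (g := toB6 (geo9Y x) 1 H₀) 𝔬.blk 𝔬.blk ((𝔬.Gsq U c * mulOp (𝔬.h c)) ∘ₗ 𝔡.Dsd U μ)
      (fun (y y' : (geo9Y x).Site) => BM * (geo9Y x).len y ^ (1 : ℝ) * Real.exp (-(δM * (geo9Y x).dist y y'))))
    {ρ' : ℝ} (hρ'0 : 0 ≤ ρ') (hρ' : ρ' ≤ δM / 2) :
    FactorsL2Mixed37Dir 𝔬 𝔡 𝔩 1 H₀ (θ₀ * Real.exp ((3 / 4 + ρ') * ρ) * (BLeg d ℓ hd hL b₀ b₁ Mstar hδM * BM)) ρ' U :=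
  (factorsL2Mixed37Dir_memberY_of_legs d ℓ hd hL b₀ b₁ Mstar hδM).choose_spec.choose_spec.2.2 x hM H₀ 𝔬 𝔡 𝔩 U hs hκ hθ₀ hCℓ hi hPt hCt hBM hMix hOne hρ'0 hρ'

/-! ## §3 The certificate-shaped reader: rows 18's `hfacO` from the displayed legs `hMixO`, `hOneO` -/

/-- ★★★ **ROWS 18's MIXED FACTOR AT A GENERIC CUBE LETTER FROM THE DISPLAYED (3.46) LEGS** (twin of `factorsL2Mixed37Dir_of_pinsR`): member families of backgrounds `B x`,
carriers and records `𝔬 x : Ops (geo9Y x) (B x) (X x) (Y x) (ι x)`, `𝔡 x`, `𝔩 x`; the certificate's regime prefix `p.M₁ ≤ M_x → α₀ > 0 → c·M_x·α₀ ≤ p.a₁ → (B x).Reg335 c α₀ U →`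
carried verbatim; displayed in that prefix: `Identities₂`, the two transposes, and the two LEGS at `(pM.BM, δ_M)`; displayed statics `StaticOK (𝔬 x) p.ρ p.Nc p.N′ p.Cℓ (κ x)`,
`(κ x).Bounded p.Kc p.θ₀ p.Cℓ M_x`, `p.OK`, `0 ≤ pM.BM`; numerics `MLeg(δ_M) ≤ p.M₁`, `p.δ₀ ≤ δ_M∕2`, `p.θ₀·e^{(3∕4+p.δ₀)p.ρ}·BLeg(δ_M)·pM.BM ≤ pM.θM` ⟹
`FactorsL2Mixed37Dir (𝔬 x) (𝔡 x) (𝔩 x) 1 (H x) pM.θM p.δ₀ U` in the same prefix — dag-n06-d's `hfacO` at `𝔬 x := opsWalkYO … (O x)`.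
[cite: Balaban1985BackgroundPropagators, (3.88)–(3.89) p.409, Thm 3.1 (3.46) p.398, Cor 3.6 p.408, (3.35) p.396; Balaban1984PropagatorsII, (2.39)–(2.44) pp.229–230, (2.52)–(2.55) p.232, Lemma 2.1 (2.59)–(2.61) pp.233–234] -/
theorem factorsL2Mixed37Dir_of_legs [∀ x : MemberY d ℓ hd hL b₀ b₁ Mstar, DecidableEq (geo9Y x).Site] {δM : ℝ} (hδM : 0 < δM) (c : ℝ)
    {B : MemberY d ℓ hd hL b₀ b₁ Mstar → B9.Backgrounds} {X Y ι : MemberY d ℓ hd hL b₀ b₁ Mstar → Type}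
    [∀ x, Fintype (X x)] [∀ x, Fintype (Y x)] [∀ x, Fintype (ι x)]
    (H : MemberY d ℓ hd hL b₀ b₁ Mstar → Prop)
    (𝔬 : ∀ x : MemberY d ℓ hd hL b₀ b₁ Mstar, Ops (geo9Y x) (B x) (X x) (Y x) (ι x))
    (𝔡 : ∀ x : MemberY d ℓ hd hL b₀ b₁ Mstar, DirOps37 (𝔬 x) (Fin (d + 1))) (𝔩 : ∀ x : MemberY d ℓ hd hL b₀ b₁ Mstar, DirLetters37 (𝔬 x) (Fin (d + 1)))
    (p : PinPrims) (hp : p.OK) (pM : MixedPrims) (hBM0 : 0 ≤ pM.BM) (κ : MemberY d ℓ hd hL b₀ b₁ Mstar → Sizes)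
    (hst : ∀ x, StaticOK (𝔬 x) p.ρ p.Nc p.N' p.Cℓ (κ x)) (hκ : ∀ x, (κ x).Bounded p.Kc p.θ₀ p.Cℓ (geo9Y x).M)
    -- the displayed families, in the certificate's regime prefix
    (hIds : ∀ x : MemberY d ℓ hd hL b₀ b₁ Mstar, p.M₁ ≤ (geo9Y x).M → ∀ α₀ : ℝ, 0 < α₀ → c * (geo9Y x).M * α₀ ≤ p.a₁ →
      ∀ U : (B x).Cfg, (B x).Reg335 c α₀ U → Identities₂ (𝔬 x) (𝔡 x) (𝔩 x) 1 (H x) U)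
    (hPt : ∀ x : MemberY d ℓ hd hL b₀ b₁ Mstar, p.M₁ ≤ (geo9Y x).M → ∀ α₀ : ℝ, 0 < α₀ → c * (geo9Y x).M * α₀ ≤ p.a₁ →
      ∀ U : (B x).Cfg, (B x).Reg335 c α₀ U → ∀ q' μ, IsTransposePair ((𝔩 x).Pt U q' μ) ((𝔩 x).P U q' μ))
    (hCt : ∀ x : MemberY d ℓ hd hL b₀ b₁ Mstar, p.M₁ ≤ (geo9Y x).M → ∀ α₀ : ℝ, 0 < α₀ → c * (geo9Y x).M * α₀ ≤ p.a₁ →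
      ∀ U : (B x).Cfg, (B x).Reg335 c α₀ U → ∀ q', IsTransposePair ((𝔬 x).Ct U q') ((𝔬 x).Cop U q'))
    -- the two per-cube (3.46) LEGS at the generic cube letter, displayed
    (hMix : ∀ x : MemberY d ℓ hd hL b₀ b₁ Mstar, p.M₁ ≤ (geo9Y x).M → ∀ α₀ : ℝ, 0 < α₀ → c * (geo9Y x).M * α₀ ≤ p.a₁ →
      ∀ U : (B x).Cfg, (B x).Reg335 c α₀ U → ∀ (q' : ι x) (ν μ : Fin (d + 1)),
        BlockBd (g := toB6 (geo9Y x) 1 (H x)) (𝔬 x).blk (𝔬 x).blk ((𝔡 x).Dd U ν ∘ₗ (((𝔬 x).Gsq U q' * mulOp ((𝔬 x).h q')) ∘ₗ (𝔡 x).Dsd U μ))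
          (fun (y y' : (geo9Y x).Site) => pM.BM * Real.exp (-(δM * (geo9Y x).dist y y'))))
    (hOne : ∀ x : MemberY d ℓ hd hL b₀ b₁ Mstar, p.M₁ ≤ (geo9Y x).M → ∀ α₀ : ℝ, 0 < α₀ → c * (geo9Y x).M * α₀ ≤ p.a₁ →
      ∀ U : (B x).Cfg, (B x).Reg335 c α₀ U → ∀ (q' : ι x) (μ : Fin (d + 1)),
        BlockBd (g := toB6 (geo9Y x) 1 (H x)) (𝔬 x).blk (𝔬 x).blk (((𝔬 x).Gsq U q' * mulOp ((𝔬 x).h q')) ∘ₗ (𝔡 x).Dsd U μ)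
          (fun (y y' : (geo9Y x).Site) => pM.BM * (geo9Y x).len y ^ (1 : ℝ) * Real.exp (-(δM * (geo9Y x).dist y y'))))
    -- the three numeric side conditions at the NAMED constants
    (hM1 : MLeg d ℓ hd hL b₀ b₁ Mstar hδM ≤ p.M₁) (hδ1 : p.δ₀ ≤ δM / 2)
    (hθ1 : p.θ₀ * Real.exp ((3 / 4 + p.δ₀) * p.ρ) * (BLeg d ℓ hd hL b₀ b₁ Mstar hδM * pM.BM) ≤ pM.θM) :
    ∀ x : MemberY d ℓ hd hL b₀ b₁ Mstar, p.M₁ ≤ (geo9Y x).M → ∀ α₀ : ℝ, 0 < α₀ → c * (geo9Y x).M * α₀ ≤ p.a₁ →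
      ∀ U : (B x).Cfg, (B x).Reg335 c α₀ U → FactorsL2Mixed37Dir (𝔬 x) (𝔡 x) (𝔩 x) 1 (H x) pM.θM p.δ₀ U := fun x hM α₀ hα ha U hU =>
  factorsL2Mixed37Dir_mono (𝔬 x) (𝔡 x) (𝔩 x) U
    (mul_nonneg (mul_nonneg hp.θ₀_nn (Real.exp_nonneg _)) (mul_nonneg (BLeg_pos d ℓ hd hL b₀ b₁ Mstar hδM).le hBM0)) hθ1 le_rfl
    (hst x).dnn (hst x).lenpos
    (factorsL2Mixed37Dir_memberY_of_legs_at d ℓ hd hL b₀ b₁ Mstar hδM x (hM1.trans hM) (H x) (𝔬 x) (𝔡 x) (𝔩 x) U (hst x) (hκ x) hp.θ₀_nn hp.one_le_Cℓ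
      (hIds x hM α₀ hα ha U hU) (hPt x hM α₀ hα ha U hU) (hCt x hM α₀ hα ha U hU) hBM0 (hMix x hM α₀ hα ha U hU) (hOne x hM α₀ hα ha U hU)
      hp.δ₀_pos.le hδ1)

end StageY

end Literature.MathematicalPhysics.QuantumFieldTheory.Balaban1983to89.B9RWSums346MixedFactorOfLegsY

end
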